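import Mathlib.MeasureTheory.Function.LpSeminorm.CompareExp
import Literature.NumberTheory.LFunctions.DeBruijnPhiDeriv
import Literature.NumberTheory.LFunctions.DeBruijnNewmanProofs
import Literature.NumberTheory.LFunctions.RiemannXiFourier
import Literature.NumberTheory.LFunctions.WeilExplicit
import HarnessLib

/-!
# The odd theta vector `H_a = −Φ′·𝟙_{[−a,a]}` of the windowed Weil form

Topic `Literature/NumberTheory/LFunctions`; a sibling of `WeilExplicit.lean` (Weil's functional in the
ADDITIVE variable `t = log x`, symmetric at `1/2`: `weilMellin g s = ĝ(s) = ∫ g(t) e^{(s − 1/2)t} dt`, so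
that `ĝ(1/2 + iτ) = ∫ g(t) e^{iτt} dt`) and of `DeBruijnNewman.lean` / `DeBruijnPhiDeriv.lean` (the
Pólya–de Bruijn kernel `deBruijnPhi` in the Rodgers–Tao normalisation and its derivative
`deBruijnPhiDeriv`). Definition item `defn-weilOddThetaVector` of route
`RiemannHypothesis/OddSector` (crux `OddBartaFloor`).

## The change of variable (which `Φ`?)

Three normalisations of Riemann's kernel occur in the tree:

* Rodgers–Tao (2020) eq. (2): `Φ_RT(u) = deBruijnPhi u = Σ_{n≥1} (2π²n⁴e^{9u} − 3πn²e^{5u}) e^{−πn²e^{4u}}`,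
  with `H₀(z) = ∫₀^∞ Φ_RT(u) cos(zu) du = ξ(1/2 + iz/2)/8` (`deBruijnH_zero_eq_holds`);
* Lagarias–Montague (2011) eq. (3.4) as formalised in `RiemannXiFourier.lean`:
  `Ψ(u) = LagariasMontague.Psi u = Φ_RT(u/4)`, with `ξ(1/2 + it) = 𝓕 Ψ (t/4π)`;
* Titchmarsh (1986) (10.1.3)–(10.1.4) = Lagarias–Montague Lemma 3.1 (3.3)–(3.4):
  `Φ(u) = Σ_{n≥1} (4π²n⁴e^{9u/2} − 6πn²e^{5u/2}) e^{−πn²e^{2u}}`, with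
  `Ξ(t) = ξ(1/2 + it) = 2∫₀^∞ Φ(u) cos(ut) du = ∫_ℝ Φ(u) e^{itu} du`.

The LAST one is the kernel of Weil's additive variable: comparing with `ĝ(1/2 + iτ) = ∫ g(t)e^{iτt} dt`
gives `Φ̂(s) = ξ(s)` with constant exactly `1` (`riemannXi 0 = 1/2 = Φ̂(0) = ∫Φ`), and the dictionary is
`Φ(t) = 2 Φ_RT(t/2) = 2 Ψ(2t)` (`weilThetaPhi`, `weilThetaPhi_eq_two_mul_Psi`, `weilThetaPhi_eq_tsum`).
Consequently `Φ′(t) = Φ_RT′(t/2) = deBruijnPhiDeriv (t/2)` (`weilThetaPhiDeriv`,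
`hasDerivAt_weilThetaPhi`), and one integration by parts gives `(Φ′)^(s) = −(s − 1/2) ξ(s)`: the
transform of `Φ′` vanishes at every nontrivial zero of `ζ`, on or off the critical line, so by the explicit
formula (`explicit_formula_holds`) `Φ′` is a null vector of Weil's form, `W(g ⋆ (Φ′)~) = 0` for every test
`g` (modulo the extension of the explicit formula from compactly supported to super-exponentially
decaying smooth tests). The identities `Φ̂ = ξ`, `(Φ′)^ = −(s − 1/2)ξ` are NOT proved in this file (they are
the business of a companion "Mellin" file); here they only fix the normalisation, which is pinned down
formally by `weilThetaPhi_eq_two_mul_Psi` + `LagariasMontague.riemannXi_criticalLine_eq_fourier`.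

## What is defined

* `weilThetaPhi t = 2 * deBruijnPhi (t / 2)` — Riemann's kernel `Φ` in Weil's additive variable
  (Titchmarsh (10.1.4)); even, positive, super-exponentially decaying;
* `weilThetaPhiDeriv t = deBruijnPhiDeriv (t / 2)` — its derivative `Φ′` (odd, `Φ′(0) = 0`);
* `weilOddThetaVector a = 𝟙_{[−a,a]} · (−Φ′)` — the ODD THETA VECTOR `H_a(t) := −Φ′(t)𝟙_{[−a,a]}(t)` of
  the 2001 programme's route `odd-sector-eigenfunction-sign` (results §§2–3: Lemma 2.1
  `(Φ′)^(s) = −(s − 1/2)ξ(s)`, Thm. 3.2 `H_a ∈ D(A_a)` with the sign decomposition of `A_aH_a`; internal,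
  unpublished — see `docs/m5/inspiration/RiemannHypothesis/RiemannHypothesis/rh-odd-sector-eigenfunction-sign.md`),
  the odd twin of the (even) theta vector `G_a = Φ𝟙_{[−a,a]}` of the theta-level Barta inequality.

## API (all proved; no named facts)

`weilThetaPhi`: the printed series (`weilThetaPhi_eq_tsum`), `= 2Ψ(2·)` (`weilThetaPhi_eq_two_mul_Psi`),
even (`weilThetaPhi_neg`), `> 0` (`weilThetaPhi_pos`), continuous, `HasDerivAt … (weilThetaPhiDeriv t)`,
`deriv` form, super-exponential bound `Φ(t) ≤ C exp(9|t|/2 − πe^{2|t|})` (`weilThetaPhi_le_exp`);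
`weilThetaPhiDeriv`: continuous, odd (`weilThetaPhiDeriv_neg`, from the new `deBruijnPhiDeriv_neg`),
`Φ′(0) = 0`; `weilOddThetaVector a`: values on/off the window, odd (`weilOddThetaVector_neg`), `H_a(0) = 0`,
support and `tsupport ⊆ [−a,a]`, compact support, continuous on the window, measurable, bounded,
integrable, `MemLp _ p` for every `p` (in particular `L²`), and `= 0` for `a < 0` (empty window, the only
junk case). NOT here (wanted by the route, separate proposals): `Φ′ < 0` on `(0,∞)` (Wintner 1935;
Lagarias–Montague Lemma 3.1 (5)), whence `H_a > 0` on `(0, a]`; and the Mellin identities above.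

## References

* E. C. Titchmarsh, *The Theory of the Riemann Zeta-Function*, 2nd ed. (1986), §10.1,
  eqs. (10.1.3)–(10.1.4), p. 255. [Titchmarsh1986]
* J. C. Lagarias, D. Montague, *The integral of the Riemann ξ-function*, Comment. Math. Univ. St. Pauli 60
  (2011), Lemma 3.1, eqs. (3.3)–(3.4) and items (2), (3), (5). [LagariasMontague2011]
* B. Rodgers, T. Tao, *The de Bruijn–Newman constant is non-negative*, Forum Math. Pi 8 (2020), §1
  eqs. (1)–(3). [RodgersTao2020]
* E. Bombieri, *Remarks on Weil's quadratic functional in the theory of prime numbers I*, Rend. Lincei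
  (9) 11 (2000), §2 (the additive/multiplicative dictionary `x = e^t`). [Bombieri2000Weil]
* 2001 programme, route `summits/rh/routes/odd-sector-eigenfunction-sign` (internal, unpublished):
  results §§2–4 (odd theta vector `H_a`, Barta floor); inspiration note cited above.
-/

noncomputable section

open Set MeasureTheory Filter
open scoped Real Topology ENNReal

namespace Literature.NumberTheory.LFunctions

/-! ## Riemann's kernel `Φ` in Weil's additive variable, and its derivative -/

/-- **Riemann's kernel in Weil's additive variable**:
`Φ(t) := 2 · deBruijnPhi (t/2) = Σ_{n≥1} (4π²n⁴e^{9t/2} − 6πn²e^{5t/2}) e^{−πn²e^{2t}}`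
(Titchmarsh (10.1.4); Lagarias–Montague (3.4)), the normalisation in which
`ξ(1/2 + iτ) = ∫_ℝ Φ(t) e^{iτt} dt`, i.e. `weilMellin Φ = ξ` in the additive, `1/2`-symmetric variable of
`WeilExplicit.lean` (see the module docstring for the dictionary with `deBruijnPhi` and
`LagariasMontague.Psi`). [cite: Titchmarsh1986, §10.1 eq. (10.1.4)] -/
def weilThetaPhi (t : ℝ) : ℝ :=
  2 * deBruijnPhi (t / 2)

/-- **The derivative `Φ′`** of Riemann's kernel in Weil's additive variable:
`Φ′(t) = deBruijnPhiDeriv (t/2)` (chain rule on `Φ(t) = 2Φ_RT(t/2)`; `hasDerivAt_weilThetaPhi`). It is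
odd with `Φ′(0) = 0`, and `(Φ′)^(s) = −(s − 1/2)ξ(s)` makes it a null vector of Weil's form. [folklore] -/
def weilThetaPhiDeriv (t : ℝ) : ℝ :=
  deBruijnPhiDeriv (t / 2)

/-- **The odd theta vector** `H_a(t) := −Φ′(t) · 𝟙_{[−a,a]}(t)` of the Weil form on the window `[−a, a]`
(2001 programme, route `odd-sector-eigenfunction-sign`, results §§2–3; `Φ = weilThetaPhi` is Riemann's
kernel in Weil's additive variable, Titchmarsh (10.1.4)). An odd, bounded, compactly supported real
function; `> 0` on `(0, a]` because `Φ` is strictly decreasing on `[0, ∞)` (Wintner 1935;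
Lagarias–Montague 2011, Lemma 3.1 (5)). For `a < 0` the window is empty and `H_a = 0`. [folklore] -/
def weilOddThetaVector (a : ℝ) : ℝ → ℝ :=
  (Icc (-a) a).indicator fun t ↦ -weilThetaPhiDeriv t

/-! ## `Φ`: series, dictionary, parity, positivity, smoothness, decay -/

/-- Unfolding: `Φ(t) = 2 Φ_RT(t/2)`. [folklore] -/
theorem weilThetaPhi_def (t : ℝ) : weilThetaPhi t = 2 * deBruijnPhi (t / 2) := rfl

/-- **Titchmarsh (10.1.4) / Lagarias–Montague (3.4) as printed**:
`Φ(t) = Σ_{n≥1} (4π²n⁴e^{9t/2} − 6πn²e^{5t/2}) e^{−πn²e^{2t}}` (summation index shifted to start at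
`n = 0`). [cite: Titchmarsh1986, §10.1 eq. (10.1.4)] -/
theorem weilThetaPhi_eq_tsum (t : ℝ) : weilThetaPhi t =
    ∑' n : ℕ, (4 * π ^ 2 * ((n : ℝ) + 1) ^ 4 * rexp (9 / 2 * t) -
      6 * π * ((n : ℝ) + 1) ^ 2 * rexp (5 / 2 * t)) * rexp (-(π * ((n : ℝ) + 1) ^ 2 * rexp (2 * t))) := by
  rw [weilThetaPhi, deBruijnPhi, ← tsum_mul_left]
  refine tsum_congr fun n => ?_
  have e9 : rexp (9 * (t / 2)) = rexp (9 / 2 * t) := by congr 1; ring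
  have e5 : rexp (5 * (t / 2)) = rexp (5 / 2 * t) := by congr 1; ring
  have e4 : rexp (4 * (t / 2)) = rexp (2 * t) := by congr 1; ring
  simp only [deBruijnPhiSummand, e9, e5, e4]
  ring

/-- **The dictionary with `RiemannXiFourier.lean`**: `Φ(t) = 2 Ψ(2t)` for Riemann's kernel
`Ψ = LagariasMontague.Psi` of that file (so `ξ(1/2 + it) = 𝓕 Ψ (t/4π)` there becomes
`ξ(1/2 + iτ) = ∫ Φ(t) e^{iτt} dt` here). [cite: LagariasMontague2011, Lemma 3.1 eq. (3.4)] -/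
theorem weilThetaPhi_eq_two_mul_Psi (t : ℝ) : weilThetaPhi t = 2 * LagariasMontague.Psi (2 * t) := by
  rw [weilThetaPhi_eq_tsum, LagariasMontague.two_mul_Psi_two_mul]

/-- `Φ` is even (theta functional equation; Lagarias–Montague Lemma 3.1 (2), in the tree
`deBruijnPhi_neg_holds`). [cite: LagariasMontague2011, Lemma 3.1 (2)] -/
theorem weilThetaPhi_neg (t : ℝ) : weilThetaPhi (-t) = weilThetaPhi t := by
  rw [weilThetaPhi, weilThetaPhi, neg_div]
  exact congrArg (2 * ·) (deBruijnPhi_neg_holds (t / 2))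

/-- `Φ > 0` everywhere (Pólya; in the tree `deBruijnPhi_pos_holds`). [folklore] -/
theorem weilThetaPhi_pos (t : ℝ) : 0 < weilThetaPhi t :=
  mul_pos two_pos (deBruijnPhi_pos_holds (t / 2))

/-- `Φ` is continuous. [folklore] -/
@[fun_prop]
theorem continuous_weilThetaPhi : Continuous weilThetaPhi :=
  continuous_const.mul (continuous_deBruijnPhi.comp (continuous_id.div_const 2))

/-- `Φ′` is continuous. [folklore] -/
@[fun_prop]
theorem continuous_weilThetaPhiDeriv : Continuous weilThetaPhiDeriv :=
  continuous_deBruijnPhiDeriv.comp (continuous_id.div_const 2)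

/-- **Chain rule**: `Φ` is differentiable with derivative `Φ′ = weilThetaPhiDeriv`
(`(2Φ_RT(t/2))′ = Φ_RT′(t/2)`). [folklore] -/
theorem hasDerivAt_weilThetaPhi (t : ℝ) : HasDerivAt weilThetaPhi (weilThetaPhiDeriv t) t := by
  have h2 : HasDerivAt (fun x : ℝ => x / 2) (1 / 2) t := by
    simpa using (hasDerivAt_id t).div_const 2
  have h := ((hasDerivAt_deBruijnPhi (t / 2)).comp t h2).const_mul 2
  have e : 2 * (deBruijnPhiDeriv (t / 2) * (1 / 2)) = weilThetaPhiDeriv t := by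
    rw [weilThetaPhiDeriv]; ring
  rw [← e]
  exact h

/-- `deriv Φ = Φ′`. [folklore] -/
theorem deriv_weilThetaPhi : deriv weilThetaPhi = weilThetaPhiDeriv :=
  funext fun t => (hasDerivAt_weilThetaPhi t).deriv

/-- `Φ` is differentiable on `ℝ`. [folklore] -/
theorem differentiable_weilThetaPhi : Differentiable ℝ weilThetaPhi := fun t =>
  (hasDerivAt_weilThetaPhi t).differentiableAt

/-- **Super-exponential decay** (Lagarias–Montague Lemma 3.1 (3); Rodgers–Tao §1): there is `C` with
`Φ(t) ≤ C exp(9|t|/2 − π e^{2|t|})` for every real `t` (from `deBruijnPhi_le_exp_holds` and evenness).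
[cite: LagariasMontague2011, Lemma 3.1 (3)] -/
theorem weilThetaPhi_le_exp :
    ∃ C : ℝ, ∀ t : ℝ, weilThetaPhi t ≤ C * rexp (9 / 2 * |t| - π * rexp (2 * |t|)) := by
  obtain ⟨C, hC⟩ := deBruijnPhi_le_exp_holds
  refine ⟨2 * C, fun t => ?_⟩
  have key : ∀ s : ℝ, 0 ≤ s → weilThetaPhi s ≤ 2 * C * rexp (9 / 2 * s - π * rexp (2 * s)) := by
    intro s hs
    have h := hC (s / 2) (by positivity)
    have e1 : (9 : ℝ) * (s / 2) = 9 / 2 * s := by ring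
    have e2 : (4 : ℝ) * (s / 2) = 2 * s := by ring
    rw [e1, e2] at h
    rw [weilThetaPhi, mul_assoc]
    exact mul_le_mul_of_nonneg_left h zero_le_two
  rcases le_or_gt 0 t with ht | ht
  · simpa [abs_of_nonneg ht] using key t ht
  · simpa [abs_of_neg ht, weilThetaPhi_neg] using key (-t) (by linarith)

/-! ## `Φ′`: parity -/

/-- **`Φ_RT′` is odd**: `deBruijnPhiDeriv (−u) = −deBruijnPhiDeriv u`, from the evenness of
`deBruijnPhi` (`deBruijnPhi_neg_holds`) and uniqueness of derivatives. [folklore] -/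
theorem deBruijnPhiDeriv_neg (u : ℝ) : deBruijnPhiDeriv (-u) = -deBruijnPhiDeriv u := by
  have hfun : (fun x => deBruijnPhi (-x)) = deBruijnPhi := funext fun x => deBruijnPhi_neg_holds x
  have hd : deriv deBruijnPhi = deBruijnPhiDeriv := funext fun x => (hasDerivAt_deBruijnPhi x).deriv
  have := deriv_comp_neg (f := deBruijnPhi) (x := -u)
  rw [hfun, neg_neg, hd] at this
  linarith

/-- `Φ′` is odd: `Φ′(−t) = −Φ′(t)`. [folklore] -/
theorem weilThetaPhiDeriv_neg (t : ℝ) : weilThetaPhiDeriv (-t) = -weilThetaPhiDeriv t := by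
  rw [weilThetaPhiDeriv, weilThetaPhiDeriv, neg_div]
  exact deBruijnPhiDeriv_neg _

/-- `Φ′(0) = 0`. [folklore] -/
theorem weilThetaPhiDeriv_zero : weilThetaPhiDeriv 0 = 0 := by
  have h := weilThetaPhiDeriv_neg 0
  rw [neg_zero] at h
  linarith

/-- `Φ_RT′(0) = 0`. [folklore] -/
theorem deBruijnPhiDeriv_zero : deBruijnPhiDeriv 0 = 0 := by
  have h := deBruijnPhiDeriv_neg 0
  rw [neg_zero] at h
  linarith

/-! ## The odd theta vector `H_a` -/

section OddThetaVector

variable {a t : ℝ}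

/-- On the window: `H_a(t) = −Φ′(t)` for `t ∈ [−a, a]`. [folklore] -/
theorem weilOddThetaVector_of_mem (h : t ∈ Icc (-a) a) :
    weilOddThetaVector a t = -weilThetaPhiDeriv t :=
  indicator_of_mem h _

/-- Off the window: `H_a(t) = 0` for `t ∉ [−a, a]`. [folklore] -/
theorem weilOddThetaVector_of_not_mem (h : t ∉ Icc (-a) a) : weilOddThetaVector a t = 0 :=
  indicator_of_notMem h _

/-- On the window, `H_a = −(deriv Φ)`. [folklore] -/
theorem weilOddThetaVector_eq_neg_deriv (h : t ∈ Icc (-a) a) :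
    weilOddThetaVector a t = -deriv weilThetaPhi t := by
  rw [weilOddThetaVector_of_mem h, deriv_weilThetaPhi]

/-- The window `[−a, a]` is symmetric. [folklore] -/
theorem neg_mem_Icc_neg_iff : -t ∈ Icc (-a) a ↔ t ∈ Icc (-a) a := by
  simp only [mem_Icc, neg_le_neg_iff, neg_le]
  exact and_comm

/-- **`H_a` is odd**: `H_a(−t) = −H_a(t)` (`Φ′` odd, window symmetric). [folklore] -/
theorem weilOddThetaVector_neg (a t : ℝ) : weilOddThetaVector a (-t) = -weilOddThetaVector a t := by
  by_cases h : t ∈ Icc (-a) a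
  · rw [weilOddThetaVector_of_mem h, weilOddThetaVector_of_mem (neg_mem_Icc_neg_iff.2 h),
      weilThetaPhiDeriv_neg, neg_neg]
  · rw [weilOddThetaVector_of_not_mem h,
      weilOddThetaVector_of_not_mem (mt neg_mem_Icc_neg_iff.1 h), neg_zero]

/-- `H_a(0) = 0`. [folklore] -/
theorem weilOddThetaVector_zero (a : ℝ) : weilOddThetaVector a 0 = 0 := by
  have h := weilOddThetaVector_neg a 0
  rw [neg_zero] at h
  linarith

/-- The junk case: for `a < 0` the window `[−a, a]` is empty and `H_a = 0`. [folklore] -/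
theorem weilOddThetaVector_of_neg (ha : a < 0) : weilOddThetaVector a = 0 := by
  funext t
  exact weilOddThetaVector_of_not_mem fun h => by
    have := h.1.trans h.2
    linarith

/-- `supp H_a ⊆ [−a, a]`. [folklore] -/
theorem support_weilOddThetaVector_subset (a : ℝ) :
    Function.support (weilOddThetaVector a) ⊆ Icc (-a) a :=
  support_indicator_subset

/-- `tsupport H_a ⊆ [−a, a]` (the window is closed). [folklore] -/
theorem tsupport_weilOddThetaVector_subset (a : ℝ) : tsupport (weilOddThetaVector a) ⊆ Icc (-a) a :=
  closure_minimal (support_weilOddThetaVector_subset a) isClosed_Icc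

/-- `H_a` has compact support. [folklore] -/
theorem hasCompactSupport_weilOddThetaVector (a : ℝ) : HasCompactSupport (weilOddThetaVector a) :=
  HasCompactSupport.intro isCompact_Icc fun _ ht => weilOddThetaVector_of_not_mem ht

/-- `H_a` is continuous on the (closed) window, where it is `−Φ′`. [folklore] -/
theorem continuousOn_weilOddThetaVector (a : ℝ) :
    ContinuousOn (weilOddThetaVector a) (Icc (-a) a) :=
  (continuous_weilThetaPhiDeriv.neg.continuousOn).congr fun _ ht => weilOddThetaVector_of_mem ht

/-- `H_a` is (Borel) measurable. [folklore] -/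
@[fun_prop]
theorem measurable_weilOddThetaVector (a : ℝ) : Measurable (weilOddThetaVector a) :=
  continuous_weilThetaPhiDeriv.neg.measurable.indicator measurableSet_Icc

/-- `H_a` is a.e. strongly measurable. [folklore] -/
theorem aestronglyMeasurable_weilOddThetaVector (a : ℝ) (μ : Measure ℝ) :
    AEStronglyMeasurable (weilOddThetaVector a) μ :=
  (measurable_weilOddThetaVector a).aestronglyMeasurable

/-- **`H_a` is bounded**: `|H_a(t)| ≤ C` for all `t`, with `C = sup_{[−a,a]} |Φ′| ≥ 0`. [folklore] -/
theorem exists_abs_weilOddThetaVector_le (a : ℝ) :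
    ∃ C : ℝ, 0 ≤ C ∧ ∀ t : ℝ, |weilOddThetaVector a t| ≤ C := by
  obtain ⟨C, hC⟩ := (isCompact_Icc (a := -a) (b := a)).exists_bound_of_continuousOn
    (continuous_weilThetaPhiDeriv.neg.continuousOn (s := Icc (-a) a))
  refine ⟨max C 0, le_max_right _ _, fun t => ?_⟩
  by_cases ht : t ∈ Icc (-a) a
  · rw [weilOddThetaVector_of_mem ht]
    exact ((Real.norm_eq_abs _).symm.trans_le (hC t ht)).trans (le_max_left _ _)
  · rw [weilOddThetaVector_of_not_mem ht, abs_zero]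
    exact le_max_right _ _

/-- `H_a` is integrable. [folklore] -/
theorem integrable_weilOddThetaVector (a : ℝ) : Integrable (weilOddThetaVector a) := by
  rw [weilOddThetaVector, integrable_indicator_iff measurableSet_Icc]
  exact (continuous_weilThetaPhiDeriv.neg.continuousOn).integrableOn_compact isCompact_Icc

/-- **`H_a ∈ Lᵖ` for every `p`** (bounded with support of finite measure); in particular `H_a ∈ L²`,
the space of the windowed Weil form. [folklore] -/
theorem memLp_weilOddThetaVector (a : ℝ) (p : ℝ≥0∞) : MemLp (weilOddThetaVector a) p volume := by
  obtain ⟨C, -, hC⟩ := exists_abs_weilOddThetaVector_le a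
  have htop : MemLp (weilOddThetaVector a) ∞ volume :=
    memLp_top_of_bound (aestronglyMeasurable_weilOddThetaVector a _) C
      (Eventually.of_forall fun t => by rw [Real.norm_eq_abs]; exact hC t)
  exact htop.mono_exponent_of_measure_support_ne_top (s := Icc (-a) a)
    (fun _ ht => weilOddThetaVector_of_not_mem ht) (by simp [Real.volume_Icc]) le_top

/-- `∫ |H_a|² < ∞` in the concrete form used by the route statements: the square is integrable.
[folklore] -/
theorem integrable_sq_weilOddThetaVector (a : ℝ) : Integrable fun t => weilOddThetaVector a t ^ 2 := by
  have h := (memLp_weilOddThetaVector a 2).integrable_norm_pow two_ne_zero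
  refine h.congr (Eventually.of_forall fun t => ?_)
  simp [Real.norm_eq_abs, sq_abs]

end OddThetaVector

end Literature.NumberTheory.LFunctions

end
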